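import Summits.CriticalPhenomena.PercolationContinuityZ3.Theorems.PercNearOneGluingNoHeavyLowerTailThreeSumAtoms
import HarnessLib

/-!
# `NoHeavyLowerTail` (stmt-CriticalPhenomena-4575) — the 3-sum theorem for R1, measure level, part 11:
# degenerate pieces (a piece missing a terminal) and the 2-cut corollaries

Support file (prover prim-gen-kcluster gen 71; `--supports stmt-CriticalPhenomena-4575`).  No definitions, no
named facts, no sorries.

A `{a,b,c}`-piece whose support has NO pair at `c` (resp. at `b`, resp. at `a`) satisfies the rows R1, LB, LG
of the instance `(a; b, c)` trivially (`rows_of_no_pair_at_c`, `rows_of_no_pair_at_b`, `rows_of_no_pair_at_a`):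
the cells `T`, `U_a` (resp. the product `φ(S)φ(U_a)`) are null.  With the 3-sum theorem (part 6) this gives the
measure-level 2-CUT LEMMAS of KCLUSTER-gen69 §5.2(b) in the strong form "whatever the near piece is":

* **`ThreeSum.r1_of_abCut`** — `G = G₁ ∪_{a,b} G₂` (supports meeting only in `{a, b}`, `c` on the `G₂` side,
  i.e. no pair of `G₁` at `c`): R1 ∧ LB ∧ LG for `G₂` ⟹ R1 for `G`, every `q > 0`; `r1_of_abCut_of_r1` —
  for `q ≥ 1`, R1 for `G₂` alone suffices (`lb_lg_of_r1`).
* by the symmetry `b ↔ c` of the hypotheses the `{a,c}`-cut is the same statement with `b, c` exchanged;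
* **`ThreeSum.r1_of_bcBridge`** — adding to a graph satisfying R1 ∧ LB ∧ LG any `{b,c}`-bridge AVOIDING `a`
  (a piece with no pair at `a`, e.g. the edge `bc` or any `b–c` connector) preserves R1 (every `q > 0`).
Hence a minimal counterexample to R1-RC (`q ≥ 1`) has no 2-cut `{a,b}` or `{a,c}` and no `{b,c}`-bridge
avoiding `a` (gen 69 §6 (C3), kernel).
-/

noncomputable section

namespace Summit.CriticalPhenomena.PercolationContinuityZ3.Theorems

namespace ThreeSum

open Finset SimpleGraph Literature.Probability.Percolation Literature.Probability.Percolation.Gladkov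
open Literature.Probability.Percolation.BHK2006 (weight)
open Literature.Probability.Percolation.DecisionTree (ind ind_of_mem ind_of_not_mem ind_nonneg)
open Literature.Probability.LatticeModels RefinedRowR3 ThreePointLB MeasureTheory
open scoped Classical

variable {V : Type*} [Fintype V]

/-! ### Pieces missing a terminal -/

section Degenerate

variable {D : Finset (Sym2 V)} {a b c : V}

/-- Inside the support, a vertex with no support pair lies in no cluster but its own. [folklore] -/
theorem not_mem_cl_of_no_pair {x y : V} (hx : ∀ e ∈ D, x ∉ e) (hxy : x ≠ y) {ω : BondConfig V} (hω : ω ⊆ ↑D) :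
    x ∉ cl ω.toFinset y := fun h => by
  obtain ⟨e, he, hxe⟩ := APL.exists_mem_edge_of_mem_cl h hxy
  rw [mem_toFinset'] at he
  exact hx e (hω he) hxe

variable (hab : a ≠ b) (hac : a ≠ c) (hbc : b ≠ c)
  (u : Sym2 V → unitInterval) {q : ℝ} (hq : 0 < q) (hu : ∀ e, e ∉ (↑D : Set (Sym2 V)) → (u e : ℝ) = 0)
include hab hac hbc hq hu

omit hab in
/-- **A piece with no pair at `c` satisfies R1, LB, LG trivially** (`T` and `U_a` are null). [this work] -/
theorem rows_of_no_pair_at_c (hc : ∀ e ∈ D, c ∉ e) : ((rcMeasureW u q ∅).real {η : BondConfig V | b ∈ cl η.toFinset a ∧ c ∈ cl η.toFinset a} * (rcMeasureW u q ∅).real {η : BondConfig V | b ∉ cl η.toFinset a ∧ c ∉ cl η.toFinset a ∧ Sep D (cl η.toFinset a) b c} ≤ (rcMeasureW u q ∅).real {η : BondConfig V | b ∈ cl η.toFinset a ∧ c ∉ cl η.toFinset a} * (rcMeasureW u q ∅).real {η : BondConfig V | b ∉ cl η.toFinset a ∧ c ∈ cl η.toFinset a}) ∧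
      ((rcMeasureW u q ∅).real {η : BondConfig V | b ∉ cl η.toFinset a ∧ c ∉ cl η.toFinset a ∧ Sep D (cl η.toFinset a) b c} * (rcMeasureW u q ∅).real {η : BondConfig V | b ∉ cl η.toFinset a ∧ c ∉ cl η.toFinset a ∧ c ∈ cl η.toFinset b} ≤ (rcMeasureW u q ∅).real {η : BondConfig V | b ∉ cl η.toFinset a ∧ c ∉ cl η.toFinset a ∧ c ∉ cl η.toFinset b ∧ ¬ Sep D (cl η.toFinset a) b c} * (rcMeasureW u q ∅).real {η : BondConfig V | b ∈ cl η.toFinset a ∧ c ∉ cl η.toFinset a}) ∧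
      ((rcMeasureW u q ∅).real {η : BondConfig V | b ∉ cl η.toFinset a ∧ c ∉ cl η.toFinset a ∧ Sep D (cl η.toFinset a) b c} * (rcMeasureW u q ∅).real {η : BondConfig V | b ∉ cl η.toFinset a ∧ c ∉ cl η.toFinset a ∧ c ∈ cl η.toFinset b} ≤ (rcMeasureW u q ∅).real {η : BondConfig V | b ∉ cl η.toFinset a ∧ c ∉ cl η.toFinset a ∧ c ∉ cl η.toFinset b ∧ ¬ Sep D (cl η.toFinset a) b c} * (rcMeasureW u q ∅).real {η : BondConfig V | b ∉ cl η.toFinset a ∧ c ∈ cl η.toFinset a}) := by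
  have hT : (rcMeasureW u q ∅).real {η : BondConfig V | b ∈ cl η.toFinset a ∧ c ∈ cl η.toFinset a} = 0 := real_eq_zero_of_support u hq hu fun ω hω h =>
    not_mem_cl_of_no_pair hc hac.symm hω h.2
  have hN : (rcMeasureW u q ∅).real {η : BondConfig V | b ∉ cl η.toFinset a ∧ c ∉ cl η.toFinset a ∧ c ∈ cl η.toFinset b} = 0 := real_eq_zero_of_support u hq hu fun ω hω h =>
    not_mem_cl_of_no_pair hc hbc.symm hω h.2.2
  rw [hT, hN, zero_mul, mul_zero]
  exact ⟨mul_nonneg measureReal_nonneg measureReal_nonneg, mul_nonneg measureReal_nonneg measureReal_nonneg,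
    mul_nonneg measureReal_nonneg measureReal_nonneg⟩

omit hac in
/-- **A piece with no pair at `b` satisfies R1, LB, LG trivially** (`T` and `U_a` are null). [this work] -/
theorem rows_of_no_pair_at_b (hb : ∀ e ∈ D, b ∉ e) : ((rcMeasureW u q ∅).real {η : BondConfig V | b ∈ cl η.toFinset a ∧ c ∈ cl η.toFinset a} * (rcMeasureW u q ∅).real {η : BondConfig V | b ∉ cl η.toFinset a ∧ c ∉ cl η.toFinset a ∧ Sep D (cl η.toFinset a) b c} ≤ (rcMeasureW u q ∅).real {η : BondConfig V | b ∈ cl η.toFinset a ∧ c ∉ cl η.toFinset a} * (rcMeasureW u q ∅).real {η : BondConfig V | b ∉ cl η.toFinset a ∧ c ∈ cl η.toFinset a}) ∧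
      ((rcMeasureW u q ∅).real {η : BondConfig V | b ∉ cl η.toFinset a ∧ c ∉ cl η.toFinset a ∧ Sep D (cl η.toFinset a) b c} * (rcMeasureW u q ∅).real {η : BondConfig V | b ∉ cl η.toFinset a ∧ c ∉ cl η.toFinset a ∧ c ∈ cl η.toFinset b} ≤ (rcMeasureW u q ∅).real {η : BondConfig V | b ∉ cl η.toFinset a ∧ c ∉ cl η.toFinset a ∧ c ∉ cl η.toFinset b ∧ ¬ Sep D (cl η.toFinset a) b c} * (rcMeasureW u q ∅).real {η : BondConfig V | b ∈ cl η.toFinset a ∧ c ∉ cl η.toFinset a}) ∧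
      ((rcMeasureW u q ∅).real {η : BondConfig V | b ∉ cl η.toFinset a ∧ c ∉ cl η.toFinset a ∧ Sep D (cl η.toFinset a) b c} * (rcMeasureW u q ∅).real {η : BondConfig V | b ∉ cl η.toFinset a ∧ c ∉ cl η.toFinset a ∧ c ∈ cl η.toFinset b} ≤ (rcMeasureW u q ∅).real {η : BondConfig V | b ∉ cl η.toFinset a ∧ c ∉ cl η.toFinset a ∧ c ∉ cl η.toFinset b ∧ ¬ Sep D (cl η.toFinset a) b c} * (rcMeasureW u q ∅).real {η : BondConfig V | b ∉ cl η.toFinset a ∧ c ∈ cl η.toFinset a}) := by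
  have hT : (rcMeasureW u q ∅).real {η : BondConfig V | b ∈ cl η.toFinset a ∧ c ∈ cl η.toFinset a} = 0 := real_eq_zero_of_support u hq hu fun ω hω h =>
    not_mem_cl_of_no_pair hb hab.symm hω h.1
  have hN : (rcMeasureW u q ∅).real {η : BondConfig V | b ∉ cl η.toFinset a ∧ c ∉ cl η.toFinset a ∧ c ∈ cl η.toFinset b} = 0 := real_eq_zero_of_support u hq hu fun ω hω h =>
    not_mem_cl_of_no_pair hb hbc hω (mem_cl_comm.1 h.2.2)
  rw [hT, hN, zero_mul, mul_zero]
  exact ⟨mul_nonneg measureReal_nonneg measureReal_nonneg, mul_nonneg measureReal_nonneg measureReal_nonneg,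
    mul_nonneg measureReal_nonneg measureReal_nonneg⟩

omit hac hbc in
/-- **A piece with no pair at `a` satisfies R1, LB, LG trivially**: `T` is null, and `φ(S)·φ(U_a) = 0` — if the
support joins `b` to `c` no configuration separates them by `C(a) = {a}`, otherwise none joins them. [this work] -/
theorem rows_of_no_pair_at_a (ha : ∀ e ∈ D, a ∉ e) : ((rcMeasureW u q ∅).real {η : BondConfig V | b ∈ cl η.toFinset a ∧ c ∈ cl η.toFinset a} * (rcMeasureW u q ∅).real {η : BondConfig V | b ∉ cl η.toFinset a ∧ c ∉ cl η.toFinset a ∧ Sep D (cl η.toFinset a) b c} ≤ (rcMeasureW u q ∅).real {η : BondConfig V | b ∈ cl η.toFinset a ∧ c ∉ cl η.toFinset a} * (rcMeasureW u q ∅).real {η : BondConfig V | b ∉ cl η.toFinset a ∧ c ∈ cl η.toFinset a}) ∧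
      ((rcMeasureW u q ∅).real {η : BondConfig V | b ∉ cl η.toFinset a ∧ c ∉ cl η.toFinset a ∧ Sep D (cl η.toFinset a) b c} * (rcMeasureW u q ∅).real {η : BondConfig V | b ∉ cl η.toFinset a ∧ c ∉ cl η.toFinset a ∧ c ∈ cl η.toFinset b} ≤ (rcMeasureW u q ∅).real {η : BondConfig V | b ∉ cl η.toFinset a ∧ c ∉ cl η.toFinset a ∧ c ∉ cl η.toFinset b ∧ ¬ Sep D (cl η.toFinset a) b c} * (rcMeasureW u q ∅).real {η : BondConfig V | b ∈ cl η.toFinset a ∧ c ∉ cl η.toFinset a}) ∧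
      ((rcMeasureW u q ∅).real {η : BondConfig V | b ∉ cl η.toFinset a ∧ c ∉ cl η.toFinset a ∧ Sep D (cl η.toFinset a) b c} * (rcMeasureW u q ∅).real {η : BondConfig V | b ∉ cl η.toFinset a ∧ c ∉ cl η.toFinset a ∧ c ∈ cl η.toFinset b} ≤ (rcMeasureW u q ∅).real {η : BondConfig V | b ∉ cl η.toFinset a ∧ c ∉ cl η.toFinset a ∧ c ∉ cl η.toFinset b ∧ ¬ Sep D (cl η.toFinset a) b c} * (rcMeasureW u q ∅).real {η : BondConfig V | b ∉ cl η.toFinset a ∧ c ∈ cl η.toFinset a}) := by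
  have hT : (rcMeasureW u q ∅).real {η : BondConfig V | b ∈ cl η.toFinset a ∧ c ∈ cl η.toFinset a} = 0 := real_eq_zero_of_support u hq hu fun ω hω h =>
    not_mem_cl_of_no_pair ha hab hω (mem_cl_comm.1 h.1)
  have hSN : (rcMeasureW u q ∅).real {η : BondConfig V | b ∉ cl η.toFinset a ∧ c ∉ cl η.toFinset a ∧ Sep D (cl η.toFinset a) b c} * (rcMeasureW u q ∅).real {η : BondConfig V | b ∉ cl η.toFinset a ∧ c ∉ cl η.toFinset a ∧ c ∈ cl η.toFinset b} = 0 := by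
    by_cases hcb : c ∈ cl D b
    · have hS : (rcMeasureW u q ∅).real {η : BondConfig V | b ∉ cl η.toFinset a ∧ c ∉ cl η.toFinset a ∧ Sep D (cl η.toFinset a) b c} = 0 := by
        refine real_eq_zero_of_support u hq hu fun ω hω hωS => hωS.2.2 ?_
        have haD : a ∉ cl D b := fun h => by
          obtain ⟨e, he, hae⟩ := APL.exists_mem_edge_of_mem_cl h hab
          exact ha e he hae
        have hW : ∀ x ∈ cl D b, x ∉ cl ω.toFinset a := fun x hx hxa =>
          not_mem_cl_of_no_pair ha (fun hax => haD (hax ▸ hx)) hω (mem_cl_comm.1 hxa)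
        exact cl_subset_cl_sdiff_touch (subset_refl D) hW hcb
      rw [hS, zero_mul]
    · have hN : (rcMeasureW u q ∅).real {η : BondConfig V | b ∉ cl η.toFinset a ∧ c ∉ cl η.toFinset a ∧ c ∈ cl η.toFinset b} = 0 := real_eq_zero_of_support u hq hu fun ω hω h =>
        hcb (cl_mono (toFinset_subset_of_subset_coe hω) b h.2.2)
      rw [hN, mul_zero]
  rw [hT, hSN, zero_mul]
  exact ⟨mul_nonneg measureReal_nonneg measureReal_nonneg, mul_nonneg measureReal_nonneg measureReal_nonneg,
    mul_nonneg measureReal_nonneg measureReal_nonneg⟩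

end Degenerate

/-! ### The 2-cut corollaries -/

section Cuts

variable {DA DB D : Finset (Sym2 V)} {a b c : V} (hab : a ≠ b) (hac : a ≠ c) (hbc : b ≠ c)
  (hsepD : ∀ v : V, (∃ e ∈ DA, v ∈ e) → (∃ e ∈ DB, v ∈ e) → (v = a ∨ v = b ∨ v = c))
  (hD : ∀ e, e ∈ D ↔ e ∈ DA ∨ e ∈ DB)
  (w wA wB : Sym2 V → unitInterval) {q : ℝ} (hq : 0 < q)
  (hw : ∀ e, e ∉ (↑DA ∪ ↑DB : Set (Sym2 V)) → (w e : ℝ) = 0)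
  (hA : ∀ e ∈ (↑DA : Set (Sym2 V)), wA e = w e) (hA' : ∀ e ∉ (↑DA : Set (Sym2 V)), wA e = 0)
  (hB : ∀ e ∈ (↑DA : Set (Sym2 V)), wB e = 0) (hB' : ∀ e ∉ (↑DA : Set (Sym2 V)), wB e = w e)
include hab hac hbc hsepD hD hq hw hA hA' hB hB'

/-- **`{a,b}`-cut lemma** (every `q > 0`): if the near piece `DA` has no pair at `c` (so the pieces meet only in
`{a, b}`), then R1 ∧ LB ∧ LG for the far piece `φ_B` gives R1 for the glued measure — whatever `DA` is.
(The `{a,c}`-cut lemma is the same statement with `b` and `c` exchanged in all hypotheses.) [this work] -/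
theorem r1_of_abCut (hc : ∀ e ∈ DA, c ∉ e)
    (hR1B : (rcMeasureW wB q ∅).real {η : BondConfig V | b ∈ cl η.toFinset a ∧ c ∈ cl η.toFinset a} * (rcMeasureW wB q ∅).real {η : BondConfig V | b ∉ cl η.toFinset a ∧ c ∉ cl η.toFinset a ∧ Sep DB (cl η.toFinset a) b c} ≤ (rcMeasureW wB q ∅).real {η : BondConfig V | b ∈ cl η.toFinset a ∧ c ∉ cl η.toFinset a} * (rcMeasureW wB q ∅).real {η : BondConfig V | b ∉ cl η.toFinset a ∧ c ∈ cl η.toFinset a}) (hLBB : (rcMeasureW wB q ∅).real {η : BondConfig V | b ∉ cl η.toFinset a ∧ c ∉ cl η.toFinset a ∧ Sep DB (cl η.toFinset a) b c} * (rcMeasureW wB q ∅).real {η : BondConfig V | b ∉ cl η.toFinset a ∧ c ∉ cl η.toFinset a ∧ c ∈ cl η.toFinset b} ≤ (rcMeasureW wB q ∅).real {η : BondConfig V | b ∉ cl η.toFinset a ∧ c ∉ cl η.toFinset a ∧ c ∉ cl η.toFinset b ∧ ¬ Sep DB (cl η.toFinset a) b c} * (rcMeasureW wB q ∅).real {η :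 BondConfig V | b ∈ cl η.toFinset a ∧ c ∉ cl η.toFinset a}) (hLGB : (rcMeasureW wB q ∅).real {η : BondConfig V | b ∉ cl η.toFinset a ∧ c ∉ cl η.toFinset a ∧ Sep DB (cl η.toFinset a) b c} * (rcMeasureW wB q ∅).real {η : BondConfig V | b ∉ cl η.toFinset a ∧ c ∉ cl η.toFinset a ∧ c ∈ cl η.toFinset b} ≤ (rcMeasureW wB q ∅).real {η : BondConfig V | b ∉ cl η.toFinset a ∧ c ∉ cl η.toFinset a ∧ c ∉ cl η.toFinset b ∧ ¬ Sep DB (cl η.toFinset a) b c} * (rcMeasureW wB q ∅).real {η : BondConfig V | b ∉ cl η.toFinset a ∧ c ∈ cl η.toFinset a}) :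
    (rcMeasureW w q ∅).real {η : BondConfig V | b ∈ cl η.toFinset a ∧ c ∈ cl η.toFinset a} * (rcMeasureW w q ∅).real {η : BondConfig V | b ∉ cl η.toFinset a ∧ c ∉ cl η.toFinset a ∧ Sep D (cl η.toFinset a) b c} ≤ (rcMeasureW w q ∅).real {η : BondConfig V | b ∈ cl η.toFinset a ∧ c ∉ cl η.toFinset a} * (rcMeasureW w q ∅).real {η : BondConfig V | b ∉ cl η.toFinset a ∧ c ∈ cl η.toFinset a} := by
  have hwA : ∀ e, e ∉ (↑DA : Set (Sym2 V)) → (wA e : ℝ) = 0 := fun e he => by rw [hA' e he]; rfl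
  obtain ⟨r1A, lbA, lgA⟩ := rows_of_no_pair_at_c hac hbc wA hq hwA hc
  exact r1_of_threeSum hab hac hbc hsepD hD w wA wB hq hw hA hA' hB hB' r1A lbA lgA hR1B hLBB hLGB

/-- **`{b,c}`-bridges avoiding `a`** (every `q > 0`): if the piece `DB` has no pair at `a`, then R1 ∧ LB ∧ LG
for `φ_A` gives R1 for the glued measure — adding any `b–c` connector avoiding `a` preserves R1. [this work] -/
theorem r1_of_bcBridge (ha : ∀ e ∈ DB, a ∉ e)
    (hR1A : (rcMeasureW wA q ∅).real {η : BondConfig V | b ∈ cl η.toFinset a ∧ c ∈ cl η.toFinset a} * (rcMeasureW wA q ∅).real {η : BondConfig V | b ∉ cl η.toFinset a ∧ c ∉ cl η.toFinset a ∧ Sep DA (cl η.toFinset a) b c} ≤ (rcMeasureW wA q ∅).real {η : BondConfig V | b ∈ cl η.toFinset a ∧ c ∉ cl η.toFinset a} * (rcMeasureW wA q ∅).real {η : BondConfig V | b ∉ cl η.toFinset a ∧ c ∈ cl η.toFinset a}) (hLBA : (rcMeasureW wA q ∅).real {η : BondConfig V | b ∉ cl η.toFinset a ∧ c ∉ cl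 η.toFinset a ∧ Sep DA (cl η.toFinset a) b c} * (rcMeasureW wA q ∅).real {η : BondConfig V | b ∉ cl η.toFinset a ∧ c ∉ cl η.toFinset a ∧ c ∈ cl η.toFinset b} ≤ (rcMeasureW wA q ∅).real {η : BondConfig V | b ∉ cl η.toFinset a ∧ c ∉ cl η.toFinset a ∧ c ∉ cl η.toFinset b ∧ ¬ Sep DA (cl η.toFinset a) b c} * (rcMeasureW wA q ∅).real {η : BondConfig V | b ∈ cl η.toFinset a ∧ c ∉ cl η.toFinset a}) (hLGA : (rcMeasureW wA q ∅).real {η : BondConfig V | b ∉ cl η.toFinset a ∧ c ∉ cl η.toFinset a ∧ Sep DA (cl η.toFinset a) b c} * (rcMeasureW wA q ∅).real {η : BondConfig V | b ∉ cl η.toFinset a ∧ c ∉ cl η.toFinset a ∧ c ∈ cl η.toFinset b} ≤ (rcMeasureW wA q ∅).real {η : BondConfig V | b ∉ cl η.toFinset a ∧ c ∉ cl η.toFinset a ∧ c ∉ cl η.toFinset b ∧ ¬ Sep DA (cl η.toFinset a) b c} * (rcMeasureW wA q ∅).real {η : BondConfig V | b ∉ cl η.toFinset a ∧ c ∈ cl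 η.toFinset a}) :
    (rcMeasureW w q ∅).real {η : BondConfig V | b ∈ cl η.toFinset a ∧ c ∈ cl η.toFinset a} * (rcMeasureW w q ∅).real {η : BondConfig V | b ∉ cl η.toFinset a ∧ c ∉ cl η.toFinset a ∧ Sep D (cl η.toFinset a) b c} ≤ (rcMeasureW w q ∅).real {η : BondConfig V | b ∈ cl η.toFinset a ∧ c ∉ cl η.toFinset a} * (rcMeasureW w q ∅).real {η : BondConfig V | b ∉ cl η.toFinset a ∧ c ∈ cl η.toFinset a} := by
  have hwB : ∀ e, e ∉ (↑DB : Set (Sym2 V)) → (wB e : ℝ) = 0 := by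
    intro e he
    by_cases heA : e ∈ (↑DA : Set (Sym2 V))
    · rw [hB e heA]; rfl
    · rw [hB' e heA]; exact hw e (fun h => h.elim heA he)
  obtain ⟨r1B, lbB, lgB⟩ := rows_of_no_pair_at_a hab wB hq hwB ha
  exact r1_of_threeSum hab hac hbc hsepD hD w wA wB hq hw hA hA' hB hB' hR1A hLBA hLGA r1B lbB lgB

omit hq in
/-- **`{a,b}`-cut lemma, `q ≥ 1`**: R1 for the far piece alone gives R1 for the glued measure. [this work] -/
theorem r1_of_abCut_of_r1 (hq1 : 1 ≤ q) (hc : ∀ e ∈ DA, c ∉ e) (hR1B : (rcMeasureW wB q ∅).real {η : BondConfig V | b ∈ cl η.toFinset a ∧ c ∈ cl η.toFinset a} * (rcMeasureW wB q ∅).real {η : BondConfig V | b ∉ cl η.toFinset a ∧ c ∉ cl η.toFinset a ∧ Sep DB (cl η.toFinset a) b c} ≤ (rcMeasureW wB q ∅).real {η : BondConfig V | b ∈ cl η.toFinset a ∧ c ∉ cl η.toFinset a} * (rcMeasureW wB q ∅).real {η : BondConfig V | b ∉ cl η.toFinset a ∧ c ∈ cl η.toFinset a}) :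
    (rcMeasureW w q ∅).real {η : BondConfig V | b ∈ cl η.toFinset a ∧ c ∈ cl η.toFinset a} * (rcMeasureW w q ∅).real {η : BondConfig V | b ∉ cl η.toFinset a ∧ c ∉ cl η.toFinset a ∧ Sep D (cl η.toFinset a) b c} ≤ (rcMeasureW w q ∅).real {η : BondConfig V | b ∈ cl η.toFinset a ∧ c ∉ cl η.toFinset a} * (rcMeasureW w q ∅).real {η : BondConfig V | b ∉ cl η.toFinset a ∧ c ∈ cl η.toFinset a} := by
  have hq : 0 < q := one_pos.trans_le hq1
  have hwB : ∀ e, e ∉ (↑DB : Set (Sym2 V)) → (wB e : ℝ) = 0 := by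
    intro e he
    by_cases heA : e ∈ (↑DA : Set (Sym2 V))
    · rw [hB e heA]; rfl
    · rw [hB' e heA]; exact hw e (fun h => h.elim heA he)
  obtain ⟨lbB, lgB⟩ := lb_lg_of_r1 hab hac hbc wB hq1 hwB hR1B
  exact r1_of_abCut hab hac hbc hsepD hD w wA wB hq hw hA hA' hB hB' hc hR1B lbB lgB

end Cuts

end ThreeSum

end Summit.CriticalPhenomena.PercolationContinuityZ3.Theorems
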